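import Summits.RiemannHypothesis.RiemannHypothesis.Theorems.PfPersistenceM2OddSectorEncard
import Summits.RiemannHypothesis.RiemannHypothesis.Theorems.PfPersistenceM2ShortWindows
import HarnessLib

/-!
# Pf-persistence index route (M2): monotonicity in the level, and the ordered thresholds

Long-odds MECHANISM SEARCH (cell `pub-rhpf`, seat M2); every result here is RH-free and makes no
claim about RH.  Notation as in `PfPersistenceM2ShortWindows`: `K = #𝒬 ∈ ℕ ∪ {∞}` counts the
off-line quadruples; `Even/Odd/RealNegIndexAtLeast n a` are the window index predicates.

PROVED here (RH-free, unconditional):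
* `RealNegIndexAtLeast.of_succ` / `.of_le` (and even / odd) — on a FIXED window the index predicates
  are monotone in the level: `n + 1` negative directions contain `n` of them (drop the last test,
  extend coefficient vectors by `0`, `Fin.snoc`);
* `exists_threshold_of_monotone` — abstract threshold lemma; `exists_oddNegIndex_threshold`,
  `exists_realNegIndex_threshold` — the odd (`n + 1 ≤ K`) and real (`n + 1 ≤ 2K`) twins of
  `exists_evenNegIndex_threshold`: a threshold `≥ (log 2)/2` below which the level is absent and above
  which it is present (Yoshida's theorem for the lower bound, the two-parity ladder for existence);
* `sInf_evenNegIndexAtLeast_mono` (and odd / real) — the thresholds are ORDERED: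
  `a_{n+1} ≤ a_{n+2}` (levels switch on in order as the window grows).
Whether any threshold exists (`K ≥ 1`) is `¬ RH` and is not addressed.
-/

noncomputable section

open Filter Set
open scoped Topology

namespace Summit.RiemannHypothesis.RiemannHypothesis.Theorems.PfPersistenceM2NegIndex

open Literature.NumberTheory.LFunctions
open Literature.NumberTheory.LFunctions.ZetaZeros
open Summit.RiemannHypothesis.RiemannHypothesis.Theorems.PfPersistenceParityIndex (OddNegIndexAtLeast)

/-! ## A. Monotonicity in the level on a fixed window -/

/-- Extending a coefficient vector by a final `0` drops the last test from the combination.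
[folklore] -/
theorem sum_realCoeff_snoc_zero_mul_eq {n : ℕ} (g : Fin (n + 1) → ℝ → ℂ) (c : Fin n → ℝ) (t : ℝ) :
    ∑ i : Fin (n + 1), (((Fin.snoc c (0 : ℝ) : Fin (n + 1) → ℝ) i : ℝ) : ℂ) * g i t =
      ∑ i : Fin n, (c i : ℂ) * g (Fin.castSucc i) t := by
  rw [Fin.sum_univ_castSucc]
  simp [Fin.snoc_castSucc, Fin.snoc_last]

/-- A non-zero coefficient vector stays non-zero after extension by `0`. [folklore] -/
theorem realCoeff_snoc_zero_ne_zero {n : ℕ} {c : Fin n → ℝ} (hc : c ≠ 0) :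
    (Fin.snoc c (0 : ℝ) : Fin (n + 1) → ℝ) ≠ 0 := by
  intro h
  apply hc
  funext i
  have := congrFun h (Fin.castSucc i)
  simpa [Fin.snoc_castSucc] using this

/-- `n + 1` negative real directions on `[-a, a]` contain `n` of them. [folklore] -/
theorem RealNegIndexAtLeast.of_succ {n : ℕ} {a : ℝ} (h : RealNegIndexAtLeast (n + 1) a) :
    RealNegIndexAtLeast n a := by
  obtain ⟨g, h1, h2, h3, h4⟩ := h
  refine ⟨fun i ↦ g (Fin.castSucc i), fun i ↦ h1 _, fun i t ↦ h2 _ t, fun i ↦ h3 _, fun c hc ↦ ?_⟩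
  have hfun : (fun t : ℝ ↦ ∑ i : Fin (n + 1), (((Fin.snoc c (0 : ℝ) : Fin (n + 1) → ℝ) i : ℝ) : ℂ) *
      g i t) = fun t : ℝ ↦ ∑ i : Fin n, (c i : ℂ) * g (Fin.castSucc i) t :=
    funext fun t ↦ sum_realCoeff_snoc_zero_mul_eq g c t
  have h5 := h4 _ (realCoeff_snoc_zero_ne_zero hc)
  rwa [hfun] at h5

/-- Even version. [folklore] -/
theorem EvenNegIndexAtLeast.of_succ {n : ℕ} {a : ℝ} (h : EvenNegIndexAtLeast (n + 1) a) :
    EvenNegIndexAtLeast n a := by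
  obtain ⟨g, h1, h2, h3, h4, h5⟩ := h
  refine ⟨fun i ↦ g (Fin.castSucc i), fun i ↦ h1 _, fun i t ↦ h2 _ t, fun i t ↦ h3 _ t, fun i ↦ h4 _,
    fun c hc ↦ ?_⟩
  have hfun : (fun t : ℝ ↦ ∑ i : Fin (n + 1), (((Fin.snoc c (0 : ℝ) : Fin (n + 1) → ℝ) i : ℝ) : ℂ) *
      g i t) = fun t : ℝ ↦ ∑ i : Fin n, (c i : ℂ) * g (Fin.castSucc i) t :=
    funext fun t ↦ sum_realCoeff_snoc_zero_mul_eq g c t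
  have h6 := h5 _ (realCoeff_snoc_zero_ne_zero hc)
  rwa [hfun] at h6

/-- Odd version. [folklore] -/
theorem oddNegIndexAtLeast_of_succ {n : ℕ} {a : ℝ} (h : OddNegIndexAtLeast (n + 1) a) :
    OddNegIndexAtLeast n a := by
  obtain ⟨g, h1, h2, h3, h4, h5⟩ := h
  refine ⟨fun i ↦ g (Fin.castSucc i), fun i ↦ h1 _, fun i t ↦ h2 _ t, fun i t ↦ h3 _ t, fun i ↦ h4 _,
    fun c hc ↦ ?_⟩
  have hfun : (fun t : ℝ ↦ ∑ i : Fin (n + 1), (((Fin.snoc c (0 : ℝ) : Fin (n + 1) → ℝ) i : ℝ) : ℂ) *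
      g i t) = fun t : ℝ ↦ ∑ i : Fin n, (c i : ℂ) * g (Fin.castSucc i) t :=
    funext fun t ↦ sum_realCoeff_snoc_zero_mul_eq g c t
  have h6 := h5 _ (realCoeff_snoc_zero_ne_zero hc)
  rwa [hfun] at h6

/-- Monotone in the level: `m ≤ n`, index `≥ n` ⟹ index `≥ m` (same window). [folklore] -/
theorem RealNegIndexAtLeast.of_le {m n : ℕ} {a : ℝ} (hmn : m ≤ n) :
    RealNegIndexAtLeast n a → RealNegIndexAtLeast m a := by
  induction n, hmn using Nat.le_induction with
  | base => exact id
  | succ k _ ih => exact fun h ↦ ih h.of_succ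

/-- Even version. [folklore] -/
theorem EvenNegIndexAtLeast.of_le {m n : ℕ} {a : ℝ} (hmn : m ≤ n) :
    EvenNegIndexAtLeast n a → EvenNegIndexAtLeast m a := by
  induction n, hmn using Nat.le_induction with
  | base => exact id
  | succ k _ ih => exact fun h ↦ ih h.of_succ

/-- Odd version. [folklore] -/
theorem oddNegIndexAtLeast_of_le {m n : ℕ} {a : ℝ} (hmn : m ≤ n) :
    OddNegIndexAtLeast n a → OddNegIndexAtLeast m a := by
  induction n, hmn using Nat.le_induction with
  | base => exact id
  | succ k _ ih => exact fun h ↦ ih (oddNegIndexAtLeast_of_succ h)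

/-! ## B. Thresholds for the odd and the real ladder -/

/-- Abstract threshold lemma: a window predicate that is monotone in `a`, absent for
`a ≤ (log 2)/2` and present somewhere has a threshold `a₀ ≥ (log 2)/2` (`a₀ = inf`). [folklore] -/
theorem exists_threshold_of_monotone {P : ℝ → Prop} (hne : ∃ a, P a)
    (hlow : ∀ a, a ≤ Real.log 2 / 2 → ¬ P a) (hmono : ∀ a b, P a → a ≤ b → P b) :
    ∃ a₀ : ℝ, Real.log 2 / 2 ≤ a₀ ∧ (∀ a < a₀, ¬ P a) ∧ ∀ a > a₀, P a := by
  have hne' : {a : ℝ | P a}.Nonempty := hne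
  have hlow' : ∀ a ∈ {a : ℝ | P a}, Real.log 2 / 2 ≤ a := fun a ha ↦ by
    by_contra hlt
    exact hlow a (le_of_lt (not_le.1 hlt)) ha
  have hbdd : BddBelow {a : ℝ | P a} := ⟨Real.log 2 / 2, hlow'⟩
  refine ⟨sInf {a : ℝ | P a}, le_csInf hne' hlow', fun a ha hPa ↦ ?_, fun a ha ↦ ?_⟩
  · exact absurd (csInf_le hbdd hPa) (not_le.2 ha)
  · obtain ⟨b, hb, hba⟩ := exists_lt_of_csInf_lt hne' ha
    exact hmono b a hb hba.le

/-- **Odd threshold at level `n + 1 ≤ K`.** [cite: Bombieri2000Weil, Thm 9 (odd part); Yoshida1992, Thm. 1] -/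
theorem exists_oddNegIndex_threshold {n : ℕ}
    (hK : ((n + 1 : ℕ) : ℕ∞) ≤ {ρ : ℂ | ρ ∈ riemannZetaNontrivialZeros ∧ 1 / 2 < ρ.re ∧ 0 < ρ.im}.encard) :
    ∃ a₀ : ℝ, Real.log 2 / 2 ≤ a₀ ∧ (∀ a < a₀, ¬ OddNegIndexAtLeast (n + 1) a) ∧
      ∀ a > a₀, OddNegIndexAtLeast (n + 1) a :=
  exists_threshold_of_monotone ((exists_oddNegIndexAtLeast_iff_encard (n + 1)).2 hK)
    (fun _ ha ↦ not_oddNegIndexAtLeast_succ_of_le_log_two_half ha n)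
    fun _ _ h hab ↦ PfPersistenceParityIndex.OddNegIndexAtLeast.mono h hab

/-- **Real threshold at level `n + 1 ≤ 2K`.** [cite: Bombieri2000Weil, Thm 8; Yoshida1992, Thm. 1] -/
theorem exists_realNegIndex_threshold {n : ℕ}
    (hK : ((n + 1 : ℕ) : ℕ∞) ≤
      2 * {ρ : ℂ | ρ ∈ riemannZetaNontrivialZeros ∧ 1 / 2 < ρ.re ∧ 0 < ρ.im}.encard) :
    ∃ a₀ : ℝ, Real.log 2 / 2 ≤ a₀ ∧ (∀ a < a₀, ¬ RealNegIndexAtLeast (n + 1) a) ∧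
      ∀ a > a₀, RealNegIndexAtLeast (n + 1) a :=
  exists_threshold_of_monotone ((exists_realNegIndexAtLeast_iff_encard (n + 1)).2 hK)
    (fun _ ha ↦ not_realNegIndexAtLeast_succ_of_le_log_two_half ha n) fun _ _ h hab ↦ h.mono hab

/-! ## C. The thresholds are ordered -/

/-- **`a_{n+1} ≤ a_{n+2}`** (even): the infimum window of level `n + 1` is at most that of level
`n + 2`, whenever level `n + 2` occurs at all (`n + 2 ≤ K`). [folklore] -/
theorem sInf_evenNegIndexAtLeast_mono {n : ℕ}
    (hK : ((n + 2 : ℕ) : ℕ∞) ≤ {ρ : ℂ | ρ ∈ riemannZetaNontrivialZeros ∧ 1 / 2 < ρ.re ∧ 0 < ρ.im}.encard) :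
    sInf {a : ℝ | EvenNegIndexAtLeast (n + 1) a} ≤ sInf {a : ℝ | EvenNegIndexAtLeast (n + 2) a} :=
  csInf_le_csInf
    ⟨Real.log 2 / 2, fun a ha ↦ by
      by_contra hlt
      exact not_evenNegIndexAtLeast_succ_of_le_log_two_half (le_of_lt (not_le.1 hlt)) n ha⟩
    ((exists_evenNegIndexAtLeast_iff_encard (n + 2)).2 hK) fun _ ha ↦ EvenNegIndexAtLeast.of_succ ha

/-- Odd version. [folklore] -/
theorem sInf_oddNegIndexAtLeast_mono {n : ℕ}
    (hK : ((n + 2 : ℕ) : ℕ∞) ≤ {ρ : ℂ | ρ ∈ riemannZetaNontrivialZeros ∧ 1 / 2 < ρ.re ∧ 0 < ρ.im}.encard) :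
    sInf {a : ℝ | OddNegIndexAtLeast (n + 1) a} ≤ sInf {a : ℝ | OddNegIndexAtLeast (n + 2) a} :=
  csInf_le_csInf
    ⟨Real.log 2 / 2, fun a ha ↦ by
      by_contra hlt
      exact not_oddNegIndexAtLeast_succ_of_le_log_two_half (le_of_lt (not_le.1 hlt)) n ha⟩
    ((exists_oddNegIndexAtLeast_iff_encard (n + 2)).2 hK) fun _ ha ↦ oddNegIndexAtLeast_of_succ ha

/-- Real version (`n + 2 ≤ 2K`). [folklore] -/
theorem sInf_realNegIndexAtLeast_mono {n : ℕ}
    (hK : ((n + 2 : ℕ) : ℕ∞) ≤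
      2 * {ρ : ℂ | ρ ∈ riemannZetaNontrivialZeros ∧ 1 / 2 < ρ.re ∧ 0 < ρ.im}.encard) :
    sInf {a : ℝ | RealNegIndexAtLeast (n + 1) a} ≤ sInf {a : ℝ | RealNegIndexAtLeast (n + 2) a} :=
  csInf_le_csInf
    ⟨Real.log 2 / 2, fun a ha ↦ by
      by_contra hlt
      exact not_realNegIndexAtLeast_succ_of_le_log_two_half (le_of_lt (not_le.1 hlt)) n ha⟩
    ((exists_realNegIndexAtLeast_iff_encard (n + 2)).2 hK) fun _ ha ↦ RealNegIndexAtLeast.of_succ ha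

end Summit.RiemannHypothesis.RiemannHypothesis.Theorems.PfPersistenceM2NegIndex

end
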